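import Summits.CriticalPhenomena.CardyFormulaZ2.Theorems.CardyAnchoredRigiditySubseqCardyFrameEquivalence
import Summits.CriticalPhenomena.CardyFormulaZ2.Theorems.CardyAnchoredRigiditySubseqCardyJointLimit

/-!
# The frame theorem: Cardy's formula on `ℤ²` ⟺ `SubseqCardy` ∧ uniqueness of the cluster point
# (crux `SubseqCardy`, stmt-CriticalPhenomena-5768, line `registered`, lead c4)

Route `CardyAnchoredRigidity` (decl shared with `CardyLocalRigidity`), sub-problem `CardyFormulaZ2`.
The two routes close the conjunct through the FRAME
`SubseqCardy ∧ ClusterSetConnected ∧ CardyShadowIsolated → CardyFormulaZ2`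
(a connected cluster set with an isolated member is that member). This file records the exact
position of the crux in that web, as one equivalence over existing declarations:

* `cardyFormulaZ2_iff_subseqCardy_and_subsingleton` (registered sub-goal) — **Cardy's formula for bond
  percolation on `ℤ²` holds if and only if (`SubseqCardy`) Cardy's values are attained along ONE mesh
  sequence for all conformal rectangles at once, AND the crossing-function path
  `δ ↦ (R ↦ bondDomainCrossingProb R δ)` has at most one cluster point as `δ → 0⁺`.**

So the crux is NECESSARY for the conjunct (not over-strong relative to the summit), and what the second
layer of either route (`ClusterSetConnected`, proved; `CardyShadowIsolated`, open) must supply is exactly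
uniqueness of the cluster point. Ingredients: the frame equivalence of this cycle
(`subseqCardy_iff_cardyShadow_clusterPt`: the crux ⟺ the Cardy shadow is a cluster point), cluster
points = joint sequential limits (`JointLimit.exists_tendsto_of_mapClusterPt`, part 4), and
precompactness of the path along every mesh sequence (`exists_strictMono_jointLimit`, S1).

References: O. Schramm, S. Smirnov, Ann. Probab. 39 (2011) §1.3; J. K. Hale, *Asymptotic Behavior of
Dissipative Systems* (1988) §3.1 (ω-limit sets).
-/

noncomputable section

namespace Summit.CriticalPhenomena.CardyFormulaZ2.Cruxes.SubseqCardy.Birth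

open Set Filter Topology
open Literature.Probability.RandomPlanarGeometry (ConformalRectangle cardyFunction crossRatio)
open Literature.Probability.Percolation (bondDomainCrossingProb)

namespace Frame

/-- **A full limit is the only cluster point**: if `bondDomainCrossingProb R δ → G R` as `δ → 0⁺` for
every conformal rectangle `R`, then every cluster point of the crossing-function path equals `G`.
[folklore] -/
theorem eq_of_mapClusterPt_of_tendsto {G g : ConformalRectangle → ℝ}
    (hG : ∀ R : ConformalRectangle, Tendsto (bondDomainCrossingProb R) (𝓝[>] (0 : ℝ)) (𝓝 (G R)))
    (hg : MapClusterPt g (𝓝[>] (0 : ℝ)) (fun (δ : ℝ) (R : ConformalRectangle) => bondDomainCrossingProb R δ)) :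
    g = G := by
  obtain ⟨v, hv, hgv⟩ := JointLimit.exists_tendsto_of_mapClusterPt hg
  funext R
  exact tendsto_nhds_unique (hgv R) ((hG R).comp hv)

/-- **Uniqueness of the cluster point gives full limits**: if the crossing-function path has at most one
cluster point as `δ → 0⁺` and `g` is one, then `bondDomainCrossingProb R δ → g R` for every `R`
(precompactness along every mesh sequence, `exists_strictMono_jointLimit`, and
`Filter.tendsto_of_subseq_tendsto`). [folklore] -/
theorem tendsto_of_subsingleton {g : ConformalRectangle → ℝ}
    (huniq : ∀ g g' : ConformalRectangle → ℝ,
      MapClusterPt g (𝓝[>] (0 : ℝ)) (fun (δ : ℝ) (R : ConformalRectangle) => bondDomainCrossingProb R δ) →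
      MapClusterPt g' (𝓝[>] (0 : ℝ)) (fun (δ : ℝ) (R : ConformalRectangle) => bondDomainCrossingProb R δ) →
      g = g')
    (hg : MapClusterPt g (𝓝[>] (0 : ℝ)) (fun (δ : ℝ) (R : ConformalRectangle) => bondDomainCrossingProb R δ))
    (R : ConformalRectangle) : Tendsto (bondDomainCrossingProb R) (𝓝[>] (0 : ℝ)) (𝓝 (g R)) := by
  refine tendsto_of_subseq_tendsto fun ns hns => ?_
  obtain ⟨φ, hφ, g', hg'⟩ := exists_strictMono_jointLimit ns hns
  refine ⟨φ, ?_⟩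
  have hu : Tendsto (fun n => ns (φ n)) atTop (𝓝[>] (0 : ℝ)) := hns.comp hφ.tendsto_atTop
  have hmem := JointLimit.mapClusterPt_of_tendsto hu hg'
  rw [huniq g g' hg hmem]
  exact hg' R

end Frame

/-- **Registered sub-goal `cardyFormulaZ2_iff_subseqCardy_and_subsingleton` (line `registered`, lead c4)
— the frame theorem.** Cardy's formula for critical bond percolation on `ℤ²` (the conjunct
`CardyFormulaZ2`: for every conformal rectangle and every uniformizing datum, `bondDomainCrossingProb R δ
→ F(crossRatio x)` as `δ → 0⁺`) holds iff (i) `SubseqCardy` (the crux: the same along ONE sequence of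
meshes, for all `R` at once) and (ii) the crossing-function path `δ ↦ (R ↦ bondDomainCrossingProb R δ)`
has at most one cluster point in the product space as `δ → 0⁺`. [cite: SchrammSmirnov2011, §1.3] -/
theorem cardyFormulaZ2_iff_subseqCardy_and_subsingleton : Literature.Probability.Percolation.CardyFormulaZ2 ↔ (Summit.CriticalPhenomena.CardyFormulaZ2.Theses.CardyAnchoredRigidity.SubseqCardy ∧ ∀ g g' : Literature.Probability.RandomPlanarGeometry.ConformalRectangle → ℝ, MapClusterPt g (nhdsWithin (0 : ℝ) (Set.Ioi 0)) (fun (δ : ℝ) (R : Literature.Probability.RandomPlanarGeometry.ConformalRectangle) => Literature.Probability.Percolation.bondDomainCrossingProb R δ) → MapClusterPt g' (nhdsWithin (0 : ℝ) (Set.Ioi 0)) (fun (δ : ℝ) (R : Literature.Probability.RandomPlanarGeometry.ConformalRectangle) => Literature.Probability.Percolation.bondDomainCrossingProb R δ) → g = g') := by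
  constructor
  · intro hC
    -- the Cardy shadow at chosen uniformizing data is the full limit
    have hdat := fun R : ConformalRectangle =>
      Literature.Probability.RandomPlanarGeometry.MarkedDomain.exists_isUniformizing_holds (n := 4) R
    set G : ConformalRectangle → ℝ := fun R =>
      cardyFunction (crossRatio (Classical.choose (Classical.choose_spec (hdat R)))) with hGdef
    have hG : ∀ R : ConformalRectangle, Tendsto (bondDomainCrossingProb R) (𝓝[>] (0 : ℝ)) (𝓝 (G R)) :=
      fun R => hC R _ _ (Classical.choose_spec (Classical.choose_spec (hdat R)))
    refine ⟨?_, fun g g' hg hg' => ?_⟩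
    · -- `SubseqCardy` along `1/(n+1)`
      refine ⟨fun n => 1 / ((n : ℝ) + 1), tendsto_one_div_strictMono_add_one_nhdsWithin_Ioi strictMono_id,
        fun R φ x hx => ?_⟩
      exact (hC R φ x hx).comp (tendsto_one_div_strictMono_add_one_nhdsWithin_Ioi strictMono_id)
    · rw [Frame.eq_of_mapClusterPt_of_tendsto hG hg, Frame.eq_of_mapClusterPt_of_tendsto hG hg']
  · rintro ⟨hSub, huniq⟩
    obtain ⟨g, hshadow, hg⟩ := subseqCardy_iff_cardyShadow_clusterPt.1 hSub
    intro R φ x hx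
    rw [← hshadow R φ x hx]
    exact Frame.tendsto_of_subsingleton huniq hg R

end Summit.CriticalPhenomena.CardyFormulaZ2.Cruxes.SubseqCardy.Birth

end
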